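import Literature.AlgebraicGeometry.Resolution.StrictTransform
import Mathlib.AlgebraicGeometry.Morphisms.SchemeTheoreticallyDominant
import HarnessLib

/-!
# The strict transform does nothing over the flat locus — PROVED (de Jong 1996, 2.18)

Topic: `Literature/AlgebraicGeometry/Resolution`. Discharge of the named fact
`DeJong1996StrictTransformFlatLocus` of `StrictTransform.lean` (de Jong 1996, 2.18: "There
exists a nonempty open subscheme `U ⊂ S` such that `X_U → U` is flat, see 2.7. Clearly,
`X'|_{ψ⁻¹(U)} ≅ X ×_S ψ⁻¹(U)`"): for `f : X → S`, `ψ : S' → S` with `S'` integral and an open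
`U ⊆ S` over which `f` is flat, the closed immersion `X' ↪ X ×_S S'` of the strict transform
(the scheme-theoretic image of the generic fibre of `pr : X ×_S S' → S'`) is an isomorphism over
`pr⁻¹(ψ⁻¹(U))`.

Proof (no Noetherian or finiteness hypothesis): let `V = ψ⁻¹(U)` and `W = pr⁻¹(V)`.

* If `V = ∅` then `W = ∅` and there is nothing to prove.
* Otherwise the generic point `η'` of `S'` lies in `V`, and `j : Spec κ(η') → S'` factors
  through `j₀ : Spec κ(η') → V`, which is quasi-compact and dominant into the reduced `V`,
  hence scheme-theoretically dominant (Mathlib `IsSchemeTheoreticallyDominant.of_isDominant`).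
* `pr|_V : W → V` is flat: it is the base change of `f|_U` along `ψ|_U : V → U` (Mathlib
  `Scheme.Hom.isPullback_resLE`).
* The restriction over `W` of the inclusion `g : (X ×_S S')_{η'} → X ×_S S'` of the generic
  fibre is the base change of `j₀` along the flat `pr|_V` (pasting of pullback squares), hence
  scheme-theoretically dominant (Mathlib `IsSchemeTheoreticallyDominant.of_isPullback`: flat base
  change preserves scheme-theoretic dominance — affine-locally, "a flat algebra over a domain
  has no torsion"), i.e. the kernel ideal sheaf of `g` vanishes on `W`.
* The kernel of the closed immersion `X' ↪ X ×_S S'` is the kernel of `g`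
  (`Scheme.IdealSheafData.ker_subschemeι`); restricted to `W` it vanishes, so the restriction is
  an isomorphism (`IsClosedImmersion.isIso_iff_ker_eq_bot`).

## Sources

* A. J. de Jong, *Smoothness, semi-stability and alterations*, Publ. Math. IHÉS 83 (1996) 51–93:
  2.18 (p. 60).
* The Stacks Project, Tag 081H (flat base change of scheme-theoretically dominant morphisms),
  Tag 01R8 (scheme-theoretic image).
-/

noncomputable section

open CategoryTheory CategoryTheory.Limits AlgebraicGeometry TopologicalSpace Topology

namespace Literature.AlgebraicGeometry.Resolution

universe u

/-! ## Generalities -/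

/-- If two quasi-compact morphisms into `W` have the same kernel ideal sheaf and the
restriction of one of them over an open `V ⊆ W` is scheme-theoretically dominant, then the
restriction of the other over `V` has trivial kernel (kernels of restrictions are computed
affine-locally from the kernel, Mathlib `Scheme.ker_morphismRestrict_ideal`). [folklore] -/
theorem ker_morphismRestrict_eq_bot_of_ker_eq {P Q W : Scheme.{u}} (c : P ⟶ W) (g : Q ⟶ W)
    [QuasiCompact c] [QuasiCompact g] (h : c.ker = g.ker) (V : W.Opens)
    [IsSchemeTheoreticallyDominant (g ∣_ V)] : (c ∣_ V).ker = ⊥ := by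
  refine Scheme.IdealSheafData.ext (funext fun O => ?_)
  rw [Scheme.ker_morphismRestrict_ideal, h, ← Scheme.ker_morphismRestrict_ideal,
    (g ∣_ V).ker_eq_bot]

/-- The generic point is dense. [folklore] -/
theorem dense_singleton_genericPoint (S' : Scheme.{u}) [IsIntegral S'] :
    Dense ({genericPoint S'} : Set S') := by
  rw [dense_iff_closure_eq]
  exact genericPoint_spec S'

/-- The lift of the generic point of an integral scheme into an open containing it is dominant.
[folklore] -/
theorem denseRange_lift_fromSpecResidueField_genericPoint {S' : Scheme.{u}} [IsIntegral S']
    (V : S'.Opens) (hV : Set.range (S'.fromSpecResidueField (genericPoint S')) ⊆ Set.range V.ι) :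
    DenseRange (IsOpenImmersion.lift V.ι (S'.fromSpecResidueField (genericPoint S')) hV) := by
  have hfac : IsOpenImmersion.lift V.ι (S'.fromSpecResidueField (genericPoint S')) hV ≫ V.ι =
      S'.fromSpecResidueField (genericPoint S') := IsOpenImmersion.lift_fac _ _ _
  have hrange : Set.range (IsOpenImmersion.lift V.ι (S'.fromSpecResidueField (genericPoint S')) hV) =
      V.ι ⁻¹' {genericPoint S'} := by
    ext v
    constructor
    · rintro ⟨x, rfl⟩
      show V.ι (IsOpenImmersion.lift V.ι (S'.fromSpecResidueField (genericPoint S')) hV x) ∈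
        ({genericPoint S'} : Set S')
      rw [← Scheme.Hom.comp_apply, hfac, ← Scheme.range_fromSpecResidueField (genericPoint S')]
      exact ⟨x, rfl⟩
    · intro hv
      have hv' : V.ι v ∈ Set.range (S'.fromSpecResidueField (genericPoint S')) := by
        rw [Scheme.range_fromSpecResidueField]
        exact hv
      obtain ⟨x, hx⟩ := hv'
      refine ⟨x, V.ι.isOpenEmbedding.injective ?_⟩
      rw [← Scheme.Hom.comp_apply, hfac]
      exact hx
  rw [DenseRange, hrange]
  exact (dense_singleton_genericPoint S').preimage V.ι.isOpenEmbedding.isOpenMap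

/-! ## The discharge -/

/-- **de Jong 1996, 2.18, "Clearly, `X'|_{ψ⁻¹(U)} ≅ X ×_S ψ⁻¹(U)`" — PROVED**: the named fact
`DeJong1996StrictTransformFlatLocus` holds. [cite: DeJong1996, 2.18, p. 60] -/
theorem DeJong1996StrictTransformFlatLocus_holds : DeJong1996StrictTransformFlatLocus.{u} := by
  intro X S S' f ψ _ U hflat
  by_cases hV : ((ψ ⁻¹ᵁ U : S'.Opens) : Set S').Nonempty
  swap
  · -- `ψ⁻¹(U) = ∅`: the target of the restriction is empty
    haveI : IsEmpty
        ((pullback.snd f ψ ⁻¹ᵁ (ψ ⁻¹ᵁ U) : (pullback f ψ).Opens) : Scheme.{u}) :=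
      ⟨fun x => hV ⟨pullback.snd f ψ x.1, x.2⟩⟩
    infer_instance
  -- the generic point of `S'` lies in `V = ψ⁻¹(U)`, and `j : Spec κ(η') → S'` lifts to `V`
  set V : S'.Opens := ψ ⁻¹ᵁ U with hVdef
  have hη : genericPoint S' ∈ V :=
    ((genericPoint_spec S').mem_open_set_iff V.isOpen).mpr (by simpa using hV)
  have hjr : Set.range (S'.fromSpecResidueField (genericPoint S')) ⊆ Set.range V.ι := by
    rw [Scheme.range_fromSpecResidueField, Scheme.Opens.range_ι]
    exact Set.singleton_subset_iff.mpr hη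
  haveI : IsReduced (V : Scheme.{u}) := isReduced_of_isOpenImmersion V.ι
  haveI : IsDominant (IsOpenImmersion.lift V.ι (S'.fromSpecResidueField (genericPoint S')) hjr) :=
    ⟨denseRange_lift_fromSpecResidueField_genericPoint V hjr⟩
  haveI : IsSchemeTheoreticallyDominant
      (IsOpenImmersion.lift V.ι (S'.fromSpecResidueField (genericPoint S')) hjr) :=
    .of_isDominant _
  -- `pr|_V : W → V` is flat, as the base change of `f|_U` along `ψ|_U`
  have hUY : pullback.snd f ψ ⁻¹ᵁ V =
      pullback.fst f ψ ⁻¹ᵁ (f ⁻¹ᵁ U) ⊓ pullback.snd f ψ ⁻¹ᵁ (ψ ⁻¹ᵁ U) := by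
    rw [← Scheme.Hom.comp_preimage (pullback.fst f ψ) f, pullback.condition,
      Scheme.Hom.comp_preimage]
    exact (inf_idem _).symm
  have hsq := Scheme.Hom.isPullback_resLE (IsPullback.of_hasPullback f ψ) (US := U)
    (UT := ψ ⁻¹ᵁ U) (UX := f ⁻¹ᵁ U) le_rfl le_rfl hUY
  have hflat' : Flat (f.resLE U (f ⁻¹ᵁ U) le_rfl) := by
    rw [Scheme.Hom.resLE_eq_morphismRestrict]
    exact hflat
  have hq := MorphismProperty.of_isPullback (P := @Flat) hsq hflat'
  haveI : Flat (pullback.snd f ψ ∣_ V) := by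
    rw [← Scheme.Hom.resLE_eq_morphismRestrict]
    exact hq
  -- the generic fibre `g : (X ×_S S')_{η'} → X ×_S S'`, restricted over `W = pr⁻¹(V)`, is the
  -- base change of `j₀` along the flat `pr|_V`, hence scheme-theoretically dominant
  set W : (pullback f ψ).Opens := pullback.snd f ψ ⁻¹ᵁ V with hWdef
  have S2 : IsPullback ((pullback.snd f ψ).fiberι (genericPoint S'))
      ((pullback.snd f ψ).fiberToSpecResidueField (genericPoint S')) (pullback.snd f ψ)
      (S'.fromSpecResidueField (genericPoint S')) :=
    IsPullback.of_hasPullback _ _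
  have S1 := isPullback_morphismRestrict ((pullback.snd f ψ).fiberι (genericPoint S')) W
  have big := S1.paste_vert S2
  have hfac : W.ι ≫ pullback.snd f ψ = (pullback.snd f ψ ∣_ V) ≫ V.ι :=
    (morphismRestrict_ι _ _).symm
  have S4 := IsOpenImmersion.isPullback_lift_id (S'.fromSpecResidueField (genericPoint S')) V.ι hjr
  have key : IsPullback
      ((((pullback.snd f ψ).fiberι (genericPoint S')) ⁻¹ᵁ W).ι ≫
        (pullback.snd f ψ).fiberToSpecResidueField (genericPoint S'))
      (((pullback.snd f ψ).fiberι (genericPoint S')) ∣_ W)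
      (IsOpenImmersion.lift V.ι (S'.fromSpecResidueField (genericPoint S')) hjr)
      (pullback.snd f ψ ∣_ V) := by
    refine IsPullback.of_right (h₁₂ := 𝟙 _) ?_ ?_ S4.flip
    · rw [Category.comp_id, ← hfac]
      exact big.flip
    · rw [← cancel_mono V.ι]
      simp only [Category.assoc]
      rw [IsOpenImmersion.lift_fac, morphismRestrict_ι, morphismRestrict_ι_assoc, S2.w]
  haveI : IsSchemeTheoreticallyDominant (((pullback.snd f ψ).fiberι (genericPoint S')) ∣_ W) :=
    IsSchemeTheoreticallyDominant.of_isPullback key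
  -- kernels: `ker (X' ↪ X ×_S S') = ker g`, which vanishes on `W`
  haveI := Literature.AlgebraicGeometry.Motives.quasiCompact_fiberι (pullback.snd f ψ)
    (genericPoint S')
  have hker : (strictTransformι f ψ).ker = ((pullback.snd f ψ).fiberι (genericPoint S')).ker :=
    Scheme.IdealSheafData.ker_subschemeι _
  have hbot : (strictTransformι f ψ ∣_ W).ker = ⊥ :=
    ker_morphismRestrict_eq_bot_of_ker_eq _ _ hker W
  haveI : IsClosedImmersion (strictTransformι f ψ ∣_ W) :=
    IsZariskiLocalAtTarget.restrict (P := @IsClosedImmersion) inferInstance W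
  exact IsClosedImmersion.isIso_iff_ker_eq_bot.mpr hbot

end Literature.AlgebraicGeometry.Resolution

end
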